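import Literature.NumberTheory.EllipticCurves.SupersingularDeuringCriterionFiniteFieldProofs
import Literature.NumberTheory.EllipticCurves.GeomPointReduction
import Mathlib.AlgebraicGeometry.EllipticCurve.IsomOfJ
import Mathlib.Algebra.Algebra.ZMod
import HarnessLib

/-!
# Supersingularity over a finite field depends only on the `j`-invariant

`Proofs` file (theorems only, no definitions, no named facts), topic `NumberTheory/EllipticCurves`;
sibling of `SupersingularDeuringCriterionFiniteFieldProofs`. Silverman, *The Arithmetic of
Elliptic Curves*, 2nd ed., Thm. V.3.1(a) (the equivalent characterisations of supersingularity,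
among them (i) `E[p^r] = 0` for one/all `r ≥ 1` and the trace condition of Ex. V.5.10(a)) with the
remark following it and Thm. V.4.1: *supersingularity is a property of the isomorphism class of `E`
over `K̄`, i.e. of `j(E)`; up to isomorphism the supersingular curves in characteristic `p` are
the finitely many with `j ∈ 𝔽_{p²}` listed by V.4.1*. Here, in the tree's currency for a curve
`V` over a finite field `K` of characteristic `p` (`a = #K + 1 − #V(K)`, supersingular iff `p ∣ a`,
`SupersingularDensityDeuringCriterionProofs`):

* `WeierstrassCurve.char_dvd_trace_iff_of_j_eq` — **for `V/K` (`K` finite, `char K = p`) and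
  `V₀/𝔽_p` elliptic with `j(V) = j(V₀)` in `K`: `p ∣ #K + 1 − #V(K) ⟺ p ∣ p + 1 − #V₀(𝔽_p)`.**

So the supersingularity of a curve over `𝔽_{p^f}` whose `j`-invariant lies in the prime field is
read off ANY curve over `𝔽_p` with that `j`-invariant. Proof: both sides say "no geometric point of
order `p`" (`dvd_trace_of_forall_nsmul_ne_zero`, `forall_nsmul_ne_zero_of_dvd_trace`); over
`K̄ = AlgebraicClosure K` the curves `V_{K̄}` and `(V₀)_{K̄}` have the same `j`, hence are isomorphic
(Mathlib `WeierstrassCurve.exists_variableChange_of_j_eq`, all characteristics), and an admissible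
change of variables induces an isomorphism of point groups (the tree's `VariableChange.pointEquiv`,
Silverman III.3.1(b)); finally `(V₀)_{K̄}` and `(V₀)_{𝔽̄_p}` exchange points of order `p` along
the two ring homomorphisms `𝔽̄_p ⇆ K̄` (`IsAlgClosure.equivOfAlgebraic`: `K̄` is an algebraic
closure of `𝔽_p` as well), points being pushed forward injectively along field homomorphisms
(`WeierstrassCurve.mapPointHom`).

USE (cell `b2b-bsdres`, class X12; unit `b2b-bsdres-lit-bst` gen 10): step **J2** of ROUTE J for the
named fact `deuring_not_hasUnitRootAt_of_hasCM_of_not_cmSplit` (HOME/b2b-bsdres-lit-bst/BST-BCST.md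
§14.4): the reduction `Ẽ_w` of a CM curve `E/ℚ` at a good place `w ∣ p` of a number field has
`j(Ẽ_w) = j(E) mod p ∈ 𝔽_p` (`j(E) ∈ ℤ`), so its supersingularity is that of a good `ℚ`-model
reduced mod `p`, or of `y² = x³ − x` / `y² + y = x³` when `j̃ ∈ {1728, 0}`.

## References

* [SilvermanAEC2009] J. H. Silverman, *The Arithmetic of Elliptic Curves*, 2nd ed. (2009):
  Thm. V.3.1(a) and the remark following it, Thm. V.4.1, Prop. III.3.1(b), Ex. V.5.10(a).
* [Lang1987] S. Lang, *Elliptic Functions*, 2nd ed., GTM 112 (1987), Ch. 13 §4 Thm. 12 (the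
  application: reductions of CM curves).

## Design

`noncomputable section`, `open scoped Classical`, universe `u`. The `ZMod p`-algebra structures on
`K` is introduced locally (`ZMod.algebra`); `AlgebraicClosure K` then carries Mathlib's induced
`ZMod p`-algebra structure with `IsScalarTower (ZMod p) K K̄`.
Nothing is defined; no named fact is introduced or used.
-/

noncomputable section

open scoped Classical

universe u

namespace WeierstrassCurve

open Literature.NumberTheory.EllipticCurves

/-! ## Pushing points of order `n` along maps -/

/-- A nonzero point killed by `n` is carried to such a point by any injective additive map
(private helper). [folklore] -/
private theorem exists_ne_zero_nsmul_eq_zero_of_injective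
    {A B : Type*} [AddCommGroup A] [AddCommGroup B] (f : A →+ B) (hf : Function.Injective f)
    {n : ℕ} (h : ∃ a : A, a ≠ 0 ∧ n • a = 0) : ∃ b : B, b ≠ 0 ∧ n • b = 0 := by
  obtain ⟨a, ha0, hna⟩ := h
  refine ⟨f a, fun h0 ↦ ha0 (hf (by rw [h0, map_zero])), ?_⟩
  rw [← map_nsmul, hna, map_zero]

/-- Points of order dividing `n` push forward along a homomorphism of fields `f : F → L`:
`V(F) → (V.map f)(L)` is an injective group homomorphism (`mapPointHom`; private helper).
[folklore] -/
private theorem exists_ne_zero_nsmul_eq_zero_map {F L : Type*} [Field F] [Field L]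
    (V : WeierstrassCurve F) (f : F →+* L) {n : ℕ}
    (h : ∃ P : V.toAffine.Point, P ≠ 0 ∧ n • P = 0) :
    ∃ Q : (V.map f).toAffine.Point, Q ≠ 0 ∧ n • Q = 0 :=
  exists_ne_zero_nsmul_eq_zero_of_injective (V.mapPointHom f) (V.mapPointHom_injective f) h

/-! ## Supersingularity depends only on `j` -/

section Finite

variable {K : Type u} [Field K] [Finite K] (p : ℕ) [Fact p.Prime] [CharP K p]
  (V : WeierstrassCurve K) [V.IsElliptic] (V₀ : WeierstrassCurve (ZMod p)) [V₀.IsElliptic]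

/-- Over a finite field, `p ∣ #K + 1 − #V(K)` iff `V(K̄)` has no point of order `p`
(Silverman, *AEC*, Thm. V.3.1(a) with Ex. V.5.10(a); the tree's two halves
`forall_nsmul_ne_zero_of_dvd_trace`, `dvd_trace_of_forall_nsmul_ne_zero`).
[cite: SilvermanAEC2009, Thm. V.3.1(a) and Ex. V.5.10(a)] -/
theorem char_dvd_trace_iff_forall_nsmul_ne_zero :
    (p : ℤ) ∣ (Nat.card K : ℤ) + 1 - Nat.card V.toAffine.Point ↔
      ∀ P : V.geomPoints, P ≠ 0 → p • P ≠ 0 := by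
  obtain ⟨σ, hσ⟩ := WeierstrassCurve.exists_frobenius_absoluteGaloisGroup K
  exact ⟨fun ha P hP hpP ↦ V.forall_nsmul_ne_zero_of_dvd_trace p hσ ha P hP hpP,
    fun h ↦ V.dvd_trace_of_forall_nsmul_ne_zero p hσ h⟩

/-- **Supersingularity over a finite field depends only on the `j`-invariant** (Silverman, *AEC*,
Thm. V.3.1(a) and the remark following it; Thm. V.4.1): for an elliptic curve `V` over a finite
field `K` of characteristic `p` and an elliptic curve `V₀` over `𝔽_p` with `j(V) = j(V₀)` (read
in `K` along a ring homomorphism `f₀ : 𝔽_p → K`),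
`p ∣ #K + 1 − #V(K) ⟺ p ∣ p + 1 − #V₀(𝔽_p)`. Both sides say "no geometric point of order `p`";
`V_{K̄} ≅ (V₀)_{K̄}` by Mathlib's `exists_variableChange_of_j_eq` (same `j` over the separably closed
`K̄`), the isomorphism of point groups being the tree's `VariableChange.pointEquiv`; and points of
order `p` of `V₀` over `𝔽̄_p` and over `K̄` correspond along `𝔽̄_p ≃ K̄`
(`IsAlgClosure.equivOfAlgebraic`). [cite: SilvermanAEC2009, Thm. V.3.1(a), remark, and Thm. V.4.1] -/
theorem char_dvd_trace_iff_of_j_eq (f₀ : ZMod p →+* K) (hj : V.j = f₀ V₀.j) :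
    (p : ℤ) ∣ (Nat.card K : ℤ) + 1 - Nat.card V.toAffine.Point ↔
      (p : ℤ) ∣ (p : ℤ) + 1 - Nat.card V₀.toAffine.Point := by
  have hp : p.Prime := Fact.out
  -- both sides: no geometric `p`-torsion
  have hV₀ : (p : ℤ) ∣ (p : ℤ) + 1 - Nat.card V₀.toAffine.Point ↔
      ∀ P : V₀.geomPoints, P ≠ 0 → p • P ≠ 0 := by
    have h := char_dvd_trace_iff_forall_nsmul_ne_zero p V₀
    rwa [Nat.card_zmod] at h
  rw [char_dvd_trace_iff_forall_nsmul_ne_zero p V, hV₀]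
  -- the two algebraic closures
  set Ω := AlgebraicClosure K with hΩ
  set Ω₀ := AlgebraicClosure (ZMod p) with hΩ₀
  letI : Algebra (ZMod p) K := ZMod.algebra K p
  haveI : Algebra.IsAlgebraic (ZMod p) K := Algebra.IsAlgebraic.of_finite (ZMod p) K
  let e : Ω ≃ₐ[ZMod p] Ω₀ := IsAlgClosure.equivOfAlgebraic (ZMod p) K Ω Ω₀
  -- `V_Ω` and `(V₀)_Ω` have the same `j`
  set ι : ZMod p →+* Ω := algebraMap (ZMod p) Ω with hι
  have hf₀ : (algebraMap K Ω).comp f₀ = ι := Subsingleton.elim _ _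
  have hjΩ : (V.baseChange Ω).j = (V₀.map ι).j := by
    change (V.map (algebraMap K Ω)).j = (V₀.map ι).j
    rw [map_j, map_j, hj, ← RingHom.comp_apply, hf₀]
  obtain ⟨C, hC⟩ := WeierstrassCurve.exists_variableChange_of_j_eq (V.baseChange Ω) (V₀.map ι) hjΩ
  -- the isomorphism of point groups `V(Ω) ≃+ (V₀.map ι)(Ω)`
  let eV : V.geomPoints ≃+ (V₀.map ι).toAffine.Point :=
    (VariableChange.pointEquiv (V.baseChange Ω) C).trans (Affine.Point.congrEquiv hC)
  -- `V₀` read over `Ω₀` along `e ∘ ι` and over `Ω` along `e⁻¹ ∘ algebraMap`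
  have hι₀ : (e.toAlgHom.toRingHom).comp ι = algebraMap (ZMod p) Ω₀ := Subsingleton.elim _ _
  have hι₁ : (e.symm.toAlgHom.toRingHom).comp (algebraMap (ZMod p) Ω₀) = ι := Subsingleton.elim _ _
  have hcurve₀ : (V₀.map ι).map e.toAlgHom.toRingHom = V₀.baseChange Ω₀ := by
    rw [map_map, hι₀]; rfl
  have hcurve₁ : (V₀.baseChange Ω₀).map e.symm.toAlgHom.toRingHom = V₀.map ι := by
    change (V₀.map (algebraMap (ZMod p) Ω₀)).map e.symm.toAlgHom.toRingHom = V₀.map ι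
    rw [map_map, hι₁]
  constructor
  · -- no `p`-torsion on `V(Ω)` ⟹ none on `V₀(Ω₀)`
    intro hV P hP0 hpP
    -- push `P ∈ V₀(Ω₀)` to `V₀(Ω)` along `e⁻¹`, then to `V(Ω)` along `eV⁻¹`
    have h1 : ∃ Q : ((V₀.baseChange Ω₀).map e.symm.toAlgHom.toRingHom).toAffine.Point,
        Q ≠ 0 ∧ p • Q = 0 :=
      exists_ne_zero_nsmul_eq_zero_map (V₀.baseChange Ω₀) e.symm.toAlgHom.toRingHom ⟨P, hP0, hpP⟩
    have h2 : ∃ Q : (V₀.map ι).toAffine.Point, Q ≠ 0 ∧ p • Q = 0 := by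
      rw [← hcurve₁]; exact h1
    obtain ⟨Q, hQ0, hpQ⟩ := exists_ne_zero_nsmul_eq_zero_of_injective eV.symm.toAddMonoidHom
      eV.symm.injective h2
    exact hV Q hQ0 hpQ
  · -- no `p`-torsion on `V₀(Ω₀)` ⟹ none on `V(Ω)`
    intro hV₀' P hP0 hpP
    have h1 : ∃ Q : (V₀.map ι).toAffine.Point, Q ≠ 0 ∧ p • Q = 0 :=
      exists_ne_zero_nsmul_eq_zero_of_injective eV.toAddMonoidHom eV.injective ⟨P, hP0, hpP⟩
    have h2 : ∃ Q : ((V₀.map ι).map e.toAlgHom.toRingHom).toAffine.Point, Q ≠ 0 ∧ p • Q = 0 :=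
      exists_ne_zero_nsmul_eq_zero_map (V₀.map ι) e.toAlgHom.toRingHom h1
    rw [hcurve₀] at h2
    obtain ⟨Q, hQ0, hpQ⟩ := h2
    exact hV₀' Q hQ0 hpQ

/-- The same with the `j`-invariants compared through an integer: if `j(V) = n` in `K` and
`j(V₀) = n` in `𝔽_p` for some `n ∈ ℤ` (the case of reductions of a curve over `ℚ` with integral
`j`, e.g. a CM curve), then `p ∣ #K + 1 − #V(K) ⟺ p ∣ p + 1 − #V₀(𝔽_p)`.
[cite: SilvermanAEC2009, Thm. V.3.1(a), remark, and Thm. V.4.1] -/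
theorem char_dvd_trace_iff_of_j_eq_intCast {n : ℤ} (hj : V.j = n) (hj₀ : V₀.j = n) :
    (p : ℤ) ∣ (Nat.card K : ℤ) + 1 - Nat.card V.toAffine.Point ↔
      (p : ℤ) ∣ (p : ℤ) + 1 - Nat.card V₀.toAffine.Point :=
  char_dvd_trace_iff_of_j_eq p V V₀ (ZMod.castHom (dvd_refl p) K) (by rw [hj, hj₀, map_intCast])

end Finite

end WeierstrassCurve

end
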